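import Mathlib
import HarnessLib

/-!
# Truncation of the interval at an endpoint singularity (Davis–Rabinowitz 1984, Sect. 2.12.2)

**Source.** P. J. Davis, P. Rabinowitz, *Methods of Numerical Integration* (2nd ed., Academic Press, 1984),
Sect. 2.12.2 "Truncation of the Interval" (p. 185).

**Statement.** For an integral `∫₀¹ F` that is improper at `0` it may be possible to estimate `∫₀^r F` without much
difficulty; if `|∫₀^r F| ≤ ε` one simply evaluates the proper integral `∫_r^1 F`. Example: for `g ∈ C[0, 1]` with
`|g| ≤ 1`, since `x^{1/2} ≤ x^{1/3}` on `[0, 1]`, `|g(x)/(x^{1/2} + x^{1/3})| ≤ 1/(2x^{1/2})`, hence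
`|∫₀^r g(x)/(x^{1/2} + x^{1/3}) dx| ≤ ½ ∫₀^r x^{-1/2} dx = r^{1/2}`; "this suggests that we take `r ≤ 10⁻⁶` for an
accuracy of `10⁻³`."

**What is typed** (all PROVED, Mathlib only):
* the principle: `integral_sub_truncated` (`∫₀¹ F − ∫_r^1 F = ∫₀^r F`) and `abs_integral_sub_truncated_le` (the error of
  truncation is `≤ ε` as soon as `|∫₀^r F| ≤ ε`);
* the example: `rpow_half_le_rpow_third` (`x^{1/2} ≤ x^{1/3}` on `[0,1]`), `two_mul_rpow_half_le_add`, the integrand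
  `truncExample g`, the pointwise bound `abs_truncExample_le`, the value `integral_inv_two_mul_sqrt`
  (`∫₀^r dx/(2x^{1/2}) = r^{1/2}`), the estimate `abs_integral_truncExample_le` (`|∫₀^r …| ≤ r^{1/2}` for `0 < r ≤ 1`),
  and the choice of `r`: `rpow_half_le_of_le_sq` (`r ≤ ε² ⇒ r^{1/2} ≤ ε`), `truncation_radius_1e6` (`(10⁻⁶)^{1/2} = 10⁻³`)
  and `abs_integral_truncExample_le_1e3` (`0 < r ≤ 10⁻⁶ ⇒ |∫₀^r …| ≤ 10⁻³`).

Not typed: the exact value `∫₀¹ dx/(x^{1/2} + x^{1/3}) = 5 − 6 log 2` (substitution `x = t⁶`).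

References: [cite: DavisRabinowitz1984, Sect. 2.12.2].
-/

noncomputable section

open Real Set MeasureTheory intervalIntegral Filter

namespace Literature.Analysis.Quadrature

/-! ## The principle -/

/-- `∫₀¹ F − ∫_r^1 F = ∫₀^r F`: truncating the interval at `r` changes the value by the (small) head integral.
[cite: DavisRabinowitz1984, Sect. 2.12.2] -/
theorem integral_sub_truncated {F : ℝ → ℝ} {r : ℝ} (h0r : IntervalIntegrable F volume 0 r)
    (hr1 : IntervalIntegrable F volume r 1) :
    (∫ x in (0 : ℝ)..1, F x) - ∫ x in r..1, F x = ∫ x in (0 : ℝ)..r, F x := by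
  rw [← integral_add_adjacent_intervals h0r hr1]; ring

/-- If `|∫₀^r F| ≤ ε` then the proper integral `∫_r^1 F` is within `ε` of `∫₀¹ F`.
[cite: DavisRabinowitz1984, Sect. 2.12.2] -/
theorem abs_integral_sub_truncated_le {F : ℝ → ℝ} {r ε : ℝ} (h0r : IntervalIntegrable F volume 0 r)
    (hr1 : IntervalIntegrable F volume r 1) (hε : |∫ x in (0 : ℝ)..r, F x| ≤ ε) :
    |(∫ x in (0 : ℝ)..1, F x) - ∫ x in r..1, F x| ≤ ε := by
  rwa [integral_sub_truncated h0r hr1]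

/-! ## The example `∫₀^r g(x) / (x^{1/2} + x^{1/3}) dx` -/

/-- On `[0, 1]`, `x^{1/2} ≤ x^{1/3}`. [cite: DavisRabinowitz1984, Sect. 2.12.2] -/
theorem rpow_half_le_rpow_third {x : ℝ} (h0 : 0 ≤ x) (h1 : x ≤ 1) :
    x ^ (1 / 2 : ℝ) ≤ x ^ (1 / 3 : ℝ) :=
  Real.rpow_le_rpow_of_exponent_ge' h0 h1 (by norm_num) (by norm_num)

/-- Hence `2x^{1/2} ≤ x^{1/2} + x^{1/3}` on `[0, 1]`. [cite: DavisRabinowitz1984, Sect. 2.12.2] -/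
theorem two_mul_rpow_half_le_add {x : ℝ} (h0 : 0 ≤ x) (h1 : x ≤ 1) :
    2 * x ^ (1 / 2 : ℝ) ≤ x ^ (1 / 2 : ℝ) + x ^ (1 / 3 : ℝ) := by
  linarith [rpow_half_le_rpow_third h0 h1]

/-- The example's integrand `g(x) / (x^{1/2} + x^{1/3})`. [cite: DavisRabinowitz1984, Sect. 2.12.2] -/
def truncExample (g : ℝ → ℝ) (x : ℝ) : ℝ := g x / (x ^ (1 / 2 : ℝ) + x ^ (1 / 3 : ℝ))

/-- Pointwise bound on `(0, 1]`: if `|g| ≤ 1` on `[0, 1]` then `|g(x)/(x^{1/2} + x^{1/3})| ≤ 1/(2x^{1/2})`.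
[cite: DavisRabinowitz1984, Sect. 2.12.2] -/
theorem abs_truncExample_le {g : ℝ → ℝ} (hg : ∀ x ∈ Icc (0 : ℝ) 1, |g x| ≤ 1) {x : ℝ} (hx : x ∈ Ioc (0 : ℝ) 1) :
    |truncExample g x| ≤ 1 / (2 * x ^ (1 / 2 : ℝ)) := by
  obtain ⟨h0, h1⟩ := hx
  have hx12 : 0 < x ^ (1 / 2 : ℝ) := Real.rpow_pos_of_pos h0 _
  have hx13 : 0 < x ^ (1 / 3 : ℝ) := Real.rpow_pos_of_pos h0 _
  have hden : 0 < x ^ (1 / 2 : ℝ) + x ^ (1 / 3 : ℝ) := by linarith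
  rw [truncExample, abs_div, abs_of_pos hden]
  calc |g x| / (x ^ (1 / 2 : ℝ) + x ^ (1 / 3 : ℝ)) ≤ 1 / (x ^ (1 / 2 : ℝ) + x ^ (1 / 3 : ℝ)) := by
        gcongr; exact hg x ⟨h0.le, h1⟩
    _ ≤ 1 / (2 * x ^ (1 / 2 : ℝ)) := by
        gcongr; exact two_mul_rpow_half_le_add h0.le h1

/-- `½ ∫₀^r x^{-1/2} dx = ∫₀^r dx/(2x^{1/2}) = r^{1/2}` (`r ≥ 0`). [cite: DavisRabinowitz1984, Sect. 2.12.2] -/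
theorem integral_inv_two_mul_sqrt {r : ℝ} (hr : 0 ≤ r) :
    ∫ x in (0 : ℝ)..r, 1 / (2 * x ^ (1 / 2 : ℝ)) = r ^ (1 / 2 : ℝ) := by
  have hcongr : ∀ x ∈ uIcc (0 : ℝ) r, 1 / (2 * x ^ (1 / 2 : ℝ)) = (1 / 2 : ℝ) * x ^ (-(1 / 2) : ℝ) := by
    intro x hx
    rw [uIcc_of_le hr] at hx
    rw [Real.rpow_neg hx.1]
    field_simp
  rw [integral_congr hcongr, intervalIntegral.integral_const_mul, integral_rpow (Or.inl (by norm_num))]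
  have h : (-(1 / 2) : ℝ) + 1 = 1 / 2 := by norm_num
  rw [h, Real.zero_rpow (by norm_num), sub_zero]
  field_simp

/-- The bound `1/(2x^{1/2})` is (improperly) integrable on `[0, r]` (`r ≥ 0`).
[cite: DavisRabinowitz1984, Sect. 2.12.2] -/
theorem intervalIntegrable_inv_two_mul_sqrt {r : ℝ} (hr : 0 ≤ r) :
    IntervalIntegrable (fun x : ℝ => 1 / (2 * x ^ (1 / 2 : ℝ))) volume 0 r := by
  have h1 : IntervalIntegrable (fun x : ℝ => (1 / 2 : ℝ) * x ^ (-(1 / 2) : ℝ)) volume 0 r :=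
    (intervalIntegral.intervalIntegrable_rpow' (by norm_num)).const_mul _
  refine h1.congr fun x hx => ?_
  rw [uIoc_of_le hr] at hx
  show (1 / 2 : ℝ) * x ^ (-(1 / 2) : ℝ) = 1 / (2 * x ^ (1 / 2 : ℝ))
  rw [Real.rpow_neg hx.1.le]
  field_simp

/-- **The truncation estimate**: for `g` with `|g| ≤ 1` on `[0, 1]` and `0 < r ≤ 1`,
`|∫₀^r g(x)/(x^{1/2} + x^{1/3}) dx| ≤ r^{1/2}`. [cite: DavisRabinowitz1984, Sect. 2.12.2] -/
theorem abs_integral_truncExample_le {g : ℝ → ℝ} (hg : ∀ x ∈ Icc (0 : ℝ) 1, |g x| ≤ 1) {r : ℝ} (hr0 : 0 < r)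
    (hr1 : r ≤ 1) : |∫ x in (0 : ℝ)..r, truncExample g x| ≤ r ^ (1 / 2 : ℝ) := by
  have h := intervalIntegral.norm_integral_le_of_norm_le (μ := volume) (f := fun x => truncExample g x)
    (g := fun x : ℝ => 1 / (2 * x ^ (1 / 2 : ℝ))) hr0.le ?_ (intervalIntegrable_inv_two_mul_sqrt hr0.le)
  · rw [integral_inv_two_mul_sqrt hr0.le] at h
    simpa [Real.norm_eq_abs] using h
  · exact Eventually.of_forall fun x hx => by
      simpa [Real.norm_eq_abs] using abs_truncExample_le hg ⟨hx.1, hx.2.trans hr1⟩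

/-! ## The choice of `r` -/

/-- `r ≤ ε²` (with `r, ε ≥ 0`) gives `r^{1/2} ≤ ε`. [cite: DavisRabinowitz1984, Sect. 2.12.2] -/
theorem rpow_half_le_of_le_sq {r ε : ℝ} (hr : 0 ≤ r) (hε : 0 ≤ ε) (h : r ≤ ε ^ 2) : r ^ (1 / 2 : ℝ) ≤ ε := by
  calc r ^ (1 / 2 : ℝ) ≤ (ε ^ 2) ^ (1 / 2 : ℝ) := Real.rpow_le_rpow hr h (by norm_num)
    _ = ε := by
      rw [← Real.sqrt_eq_rpow, Real.sqrt_sq hε]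

/-- "Take `r ≤ 10⁻⁶` for an accuracy of `10⁻³`": `(10⁻⁶)^{1/2} = 10⁻³`. [cite: DavisRabinowitz1984, Sect. 2.12.2] -/
theorem truncation_radius_1e6 : (1e-6 : ℝ) ^ (1 / 2 : ℝ) = 1e-3 := by
  rw [← Real.sqrt_eq_rpow, show (1e-6 : ℝ) = (1e-3) ^ 2 by norm_num, Real.sqrt_sq (by norm_num)]

/-- … so for `0 < r ≤ 10⁻⁶` the neglected head is at most `10⁻³` in absolute value.
[cite: DavisRabinowitz1984, Sect. 2.12.2] -/
theorem abs_integral_truncExample_le_1e3 {g : ℝ → ℝ} (hg : ∀ x ∈ Icc (0 : ℝ) 1, |g x| ≤ 1) {r : ℝ}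
    (hr0 : 0 < r) (hr : r ≤ 1e-6) : |∫ x in (0 : ℝ)..r, truncExample g x| ≤ 1e-3 := by
  have hr1 : r ≤ 1 := hr.trans (by norm_num)
  refine (abs_integral_truncExample_le hg hr0 hr1).trans ?_
  exact rpow_half_le_of_le_sq hr0.le (by norm_num) (hr.trans (by norm_num))

end Literature.Analysis.Quadrature

end
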